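import Mathlib
import Literature.Probability.Percolation.DiagonalStripJunctionTL
import Literature.Probability.Percolation.DiagonalStripGroundStateCocycle
import Literature.Probability.Percolation.DiagonalStripGenericInversion
import HarnessLib

/-!
# Symmetries of the junction pairing of an exact qKZ solution (IP12 Prop. 4.1, normalisation-free)

For a vector `ψ` on column patterns satisfying the EXACT bulk exchange relations
(`IsExactExchange`: `[q z_i/z_{i+1}] ψ − [z_i/z_{i+1}] e_i ψ = [q z_{i+1}/z_i] σ_i ψ` in the
lumped Temperley–Lieb action) we form the numerator of IP12's left-passage pairing in the
cluster language, with the TRANSPOSED bra `ψ^ι := ι_{≤L} ψ` (all rapidities inverted):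
`N(ψ) = Σ_{Q,Q'} ψ^ι_Q ψ_{Q'} [J(Q,Q')]`, `Z(ψ) = Σ_Q ψ_Q`, where `J = ipJunction m (Fin.last m)`.
Using the self-adjointness of `J` for the joins and the unmarked isolations
(`DiagonalStripJunctionTL`), we prove that `N` and `Z` are invariant under every `σ_i`,
`1 ≤ i ≤ 2m` (IP12 Prop. 4.1, first half, for `P = N/(Z ι Z)` without any normalisation), and
the inversion covariance from the top reflection `ι_L ψ = z_L^{2a} ψ`.

## References
* [IkhlefPonsaing2012] Y. Ikhlef, A. K. Ponsaing, *Finite-size left-passage probability in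
  percolation*, J. Stat. Phys. 149 (2012) 10–36, arXiv:1202.5476, Prop. 4.1 and Def. 4.2.
-/

namespace Literature.Probability.Percolation

open Finset Relation Literature.Probability.LatticeModels

variable {m : ℕ}

/-! ### Ring endomorphisms of the rapidity field are determined by the generators -/

section RFExt

open MvPolynomial

variable {K₀ : Type*} [Field K₀] {R' : Type*} [CommRing R']

/-- Two ring homomorphisms out of the rapidity field agreeing on the constants and the rapidities
are equal. [folklore] -/
theorem rapidityField_ringHom_ext {φ φ' : RapidityField K₀ →+* R'} (hC : ∀ a, φ (genC K₀ a) = φ' (genC K₀ a))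
    (hX : ∀ n, φ (genZ K₀ n) = φ' (genZ K₀ n)) : φ = φ' := by
  refine IsLocalization.ringHom_ext (nonZeroDivisors (MvPolynomial ℕ K₀)) ?_
  refine MvPolynomial.ringHom_ext (fun a => hC a) (fun n => hX n)

end RFExt

/-! ### Inverting all the vertical rapidities -/

section InvAll

open MvPolynomial Literature.Probability.LatticeModels.TemperleyLieb

variable (K₀ : Type*) [Field K₀]

/-- **`ι_L`: the endomorphism `z_k ↦ 1/z_k` for `1 ≤ k ≤ L`** (the transposition of the lattice on the
rapidities). [cite: IkhlefPonsaing2012, §4.1] -/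
noncomputable def genInvAll : ℕ → (RapidityField K₀ →+* RapidityField K₀)
  | 0 => RingHom.id _
  | L + 1 => (genInv K₀ (L + 1)).comp (genInvAll L)

variable {K₀}

/-- `ι_L` on the rapidities. [folklore] -/
theorem genInvAll_genZ (L n : ℕ) :
    genInvAll K₀ L (genZ K₀ n) = if 1 ≤ n ∧ n ≤ L then (genZ K₀ n)⁻¹ else genZ K₀ n := by
  induction L with
  | zero => simp only [genInvAll, RingHom.id_apply]; rw [if_neg (by omega)]
  | succ L ih =>
    rw [genInvAll, RingHom.comp_apply, ih]
    by_cases h : 1 ≤ n ∧ n ≤ L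
    · rw [if_pos h, map_inv₀, genInv_genZ, Function.update_of_ne (by omega), if_pos ⟨h.1, by omega⟩]
    · rw [if_neg h, genInv_genZ, Function.update_apply]
      by_cases hn : n = L + 1
      · subst hn; rw [if_pos rfl, if_pos ⟨by omega, le_rfl⟩]
      · rw [if_neg hn, if_neg (by omega)]

/-- `ι_L` on the constants. [folklore] -/
theorem genInvAll_genC (L : ℕ) (a : K₀) : genInvAll K₀ L (genC K₀ a) = genC K₀ a := by
  induction L with
  | zero => simp [genInvAll]
  | succ L ih => rw [genInvAll, RingHom.comp_apply, ih, genInv_genC]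

/-- `ι_L` fixes `w`. [folklore] -/
theorem genInvAll_genW (L : ℕ) : genInvAll K₀ L (genW K₀) = genW K₀ := by
  rw [show genW K₀ = genZ K₀ 0 from rfl, genInvAll_genZ, if_neg (by omega)]

/-- `ι_L` is an involution. [folklore] -/
theorem genInvAll_genInvAll (L : ℕ) (x : RapidityField K₀) : genInvAll K₀ L (genInvAll K₀ L x) = x := by
  have : (genInvAll K₀ L).comp (genInvAll K₀ L) = RingHom.id _ := by
    refine rapidityField_ringHom_ext (fun a => ?_) (fun n => ?_)
    · simp [genInvAll_genC]
    · simp only [RingHom.comp_apply, RingHom.id_apply, genInvAll_genZ]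
      split_ifs with h
      · rw [map_inv₀, genInvAll_genZ, if_pos h, inv_inv]
      · rw [genInvAll_genZ, if_neg h]
  exact RingHom.congr_fun this x

/-- `ι_L` is injective. [folklore] -/
theorem genInvAll_injective (L : ℕ) : Function.Injective (genInvAll K₀ L) :=
  Function.LeftInverse.injective (genInvAll_genInvAll L)

/-- `ι_L` commutes with the inner swaps `σ_i`, `1 ≤ i < L`. [folklore] -/
theorem genInvAll_genSwap {L i : ℕ} (hi : 1 ≤ i) (hiL : i + 1 ≤ L) (x : RapidityField K₀) :
    genInvAll K₀ L (genSwap K₀ i x) = genSwap K₀ i (genInvAll K₀ L x) := by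
  have : (genInvAll K₀ L).comp (genSwap K₀ i).toRingHom = (genSwap K₀ i).toRingHom.comp (genInvAll K₀ L) := by
    refine rapidityField_ringHom_ext (fun a => ?_) (fun n => ?_)
    · simp [genInvAll_genC, genSwap_genC]
    · simp only [RingHom.comp_apply, RingEquiv.toRingHom_eq_coe, RingHom.coe_coe, genSwap_genZ, genInvAll_genZ]
      rw [zswap]
      by_cases h1 : n = i
      · subst h1
        rw [if_pos rfl, genInvAll_genZ, if_pos ⟨by omega, hiL⟩, if_pos ⟨hi, by omega⟩, map_inv₀, genSwap_genZ, zswap_self]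
      · rw [if_neg h1]
        by_cases h2 : n = i + 1
        · subst h2
          rw [if_pos rfl, genInvAll_genZ, if_pos ⟨hi, by omega⟩, if_pos ⟨by omega, hiL⟩, map_inv₀, genSwap_genZ, zswap_succ]
        · rw [if_neg h2, genInvAll_genZ]
          split_ifs with h
          · rw [map_inv₀, genSwap_genZ, zswap_of_ne _ h1 h2]
          · rw [genSwap_genZ, zswap_of_ne _ h1 h2]
  exact RingHom.congr_fun this x

/-- `ι_L` commutes with the bracket. [folklore] -/
theorem genInvAll_qbr (L : ℕ) (x : RapidityField K₀) : genInvAll K₀ L (qbr x) = qbr (genInvAll K₀ L x) := by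
  unfold qbr; rw [map_sub, map_inv₀]

end InvAll

/-! ### The transposition pairing and its symmetry in the unmarked rapidities -/

section Pairing

open MvPolynomial Literature.Probability.LatticeModels.TemperleyLieb

variable {K₀ : Type*} [Field K₀] {m : ℕ}

/-- `Z = Σ_Q ψ(Q)`. [cite: IkhlefPonsaing2012, §3.6] -/
noncomputable def ipZsum (ψ : ColPattern m → RapidityField K₀) : RapidityField K₀ := ∑ Q, ψ Q

/-- **The numerator of the first-site passage probability in the cluster language**:
`N = Σ_{Q,Q'} ψ^ι(Q) ψ(Q') J(Q, Q')`, `ψ^ι = ι_L ψ` the ground state of the transposed lattice,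
`J` the junction at the marked (top) seam site. [cite: IkhlefPonsaing2012, Def. 4.1] -/
noncomputable def ipNpair (ψ : ColPattern m → RapidityField K₀) : RapidityField K₀ :=
  ∑ Q, ∑ Q', genInvAll K₀ (2 * m + 1) (ψ Q) * ψ Q' * (if ipJunction m (Fin.last m) Q Q' = true then 1 else 0)

/-- The bilinear junction form. [folklore] -/
noncomputable def ipJform (u v : ColPattern m → RapidityField K₀) : RapidityField K₀ :=
  ∑ Q, ∑ Q', u Q * v Q' * (if ipJunction m (Fin.last m) Q Q' = true then 1 else 0)

/-- `N = ⟨ψ^ι, ψ⟩_J`. [folklore] -/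
theorem ipNpair_eq (ψ : ColPattern m → RapidityField K₀) :
    ipNpair ψ = ipJform (fun Q => genInvAll K₀ (2 * m + 1) (ψ Q)) ψ := rfl

/-- The form is bilinear: left sums. [folklore] -/
theorem ipJform_add_left (u u' v : ColPattern m → RapidityField K₀) :
    ipJform (u + u') v = ipJform u v + ipJform u' v := by
  unfold ipJform; simp only [Pi.add_apply, add_mul, Finset.sum_add_distrib]

/-- The form is bilinear: right sums. [folklore] -/
theorem ipJform_add_right (u v v' : ColPattern m → RapidityField K₀) :
    ipJform u (v + v') = ipJform u v + ipJform u v' := by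
  unfold ipJform; simp only [Pi.add_apply, mul_add, add_mul, Finset.sum_add_distrib]

/-- The form is bilinear: left scalars. [folklore] -/
theorem ipJform_smul_left (c : RapidityField K₀) (u v : ColPattern m → RapidityField K₀) :
    ipJform (c • u) v = c * ipJform u v := by
  unfold ipJform; simp only [Pi.smul_apply, smul_eq_mul, Finset.mul_sum]; 
  exact Finset.sum_congr rfl fun _ _ => Finset.sum_congr rfl fun _ _ => by ring

/-- The form is bilinear: right scalars. [folklore] -/
theorem ipJform_smul_right (c : RapidityField K₀) (u v : ColPattern m → RapidityField K₀) :
    ipJform u (c • v) = c * ipJform u v := by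
  unfold ipJform; simp only [Pi.smul_apply, smul_eq_mul, Finset.mul_sum]
  exact Finset.sum_congr rfl fun _ _ => Finset.sum_congr rfl fun _ _ => by ring

/-- The lumped push-forward along a move `g` ("`e ψ`"). [folklore] -/
noncomputable def ipPush (g : ColPattern m → ColPattern m) (ψ : ColPattern m → RapidityField K₀) :
    ColPattern m → RapidityField K₀ :=
  fun Q => ∑ Q₀ ∈ Finset.univ.filter (fun Q₀ => lump (g Q₀) = Q), ψ Q₀

/-- `e` commutes with ring homomorphisms of the values. [folklore] -/
theorem map_ipPush (φ : RapidityField K₀ →+* RapidityField K₀) (g : ColPattern m → ColPattern m)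
    (ψ : ColPattern m → RapidityField K₀) (Q : ColPattern m) :
    φ (ipPush g ψ Q) = ipPush g (fun Q => φ (ψ Q)) Q := by
  unfold ipPush; rw [map_sum]

/-- `Σ_Q (e ψ)(Q) = Σ_Q ψ(Q)`. [folklore] -/
theorem sum_ipPush (g : ColPattern m → ColPattern m) (ψ : ColPattern m → RapidityField K₀) :
    ∑ Q, ipPush g ψ Q = ∑ Q, ψ Q := by
  unfold ipPush
  exact Finset.sum_fiberwise_of_maps_to (fun _ _ => Finset.mem_univ _) _

/-- `[c x] + [x] = [c/x]` at `c² + c + 1 = 0`. [cite: IkhlefPonsaing2012, §3.1] -/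
theorem qbr_quad_identity {c : RapidityField K₀} (hc : c ^ 2 + c + 1 = 0) (x : RapidityField K₀) :
    qbr (c * x) + qbr x = qbr (c / x) := by
  have hc0 : c ≠ 0 := by rintro rfl; norm_num at hc
  have hinv : c⁻¹ = -(c + 1) := inv_eq_of_mul_eq_one_right (by linear_combination -hc)
  unfold qbr
  rw [mul_inv, inv_div, div_eq_mul_inv c x, div_eq_mul_inv x c, hinv]
  ring

/-- `[1/x] = -[x]`. [folklore] -/
theorem qbr_inv' (x : RapidityField K₀) : qbr x⁻¹ = -qbr x := by unfold qbr; rw [inv_inv]; ring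

/-- The push-forward is additive. [folklore] -/
theorem ipPush_add (g : ColPattern m → ColPattern m) (u v : ColPattern m → RapidityField K₀) :
    ipPush g (u + v) = ipPush g u + ipPush g v := by
  funext Q; unfold ipPush; simp only [Pi.add_apply, Finset.sum_add_distrib]

/-- The push-forward is homogeneous. [folklore] -/
theorem ipPush_smul (g : ColPattern m → ColPattern m) (c : RapidityField K₀) (u : ColPattern m → RapidityField K₀) :
    ipPush g (c • u) = c • ipPush g u := by
  funext Q; unfold ipPush; simp only [Pi.smul_apply, smul_eq_mul, Finset.mul_sum]

/-- The push-forward of a difference of multiples. [folklore] -/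
theorem ipPush_sub_smul (g : ColPattern m → ColPattern m) (a b : RapidityField K₀) (u v : ColPattern m → RapidityField K₀) :
    ipPush g (fun Q => a * u Q - b * v Q) = fun Q => a * ipPush g u Q - b * ipPush g v Q := by
  funext Q; unfold ipPush; simp only [Finset.sum_sub_distrib, Finset.mul_sum]

variable {q : K₀} {i : ℕ} {g : ColPattern m → ColPattern m} {ψ : ColPattern m → RapidityField K₀}

/-- The data of an exact exchange relation at level `i` with move `g`:
`[c z_{i+1}/z_i] ψ - [z_i/z_{i+1}] e ψ = [c z_i/z_{i+1}] σ_i ψ`. [cite: IkhlefPonsaing2012, §3.4] -/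
def IsExactExchange (q : K₀) (i : ℕ) (g : ColPattern m → ColPattern m) (ψ : ColPattern m → RapidityField K₀) : Prop :=
  ∀ Q, qbr (genC K₀ q * genZ K₀ (i + 1) / genZ K₀ i) * ψ Q - qbr (genZ K₀ i / genZ K₀ (i + 1)) * ipPush g ψ Q =
    qbr (genC K₀ q * genZ K₀ i / genZ K₀ (i + 1)) * genSwap K₀ i (ψ Q)

/-- The ratio `x = z_i/z_{i+1}` is not a square root of `1`. [folklore] -/
theorem genRatio_sq_ne_one (i : ℕ) : (genZ K₀ i / genZ K₀ (i + 1)) ^ 2 ≠ 1 := by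
  rw [div_pow, Ne, div_eq_one_iff_eq (pow_ne_zero _ (genZ_ne_zero _))]
  unfold genZ; rw [← map_pow, ← map_pow]
  refine toRF_ne_of_eval (fun n => if n = i then 0 else 1) ?_
  simp

/-- The two outer brackets through the ratio `x = z_i/z_{i+1}`. [folklore] -/
theorem exch_coeff₁ (q : K₀) (i : ℕ) :
    genC K₀ q * genZ K₀ (i + 1) / genZ K₀ i = genC K₀ q / (genZ K₀ i / genZ K₀ (i + 1)) := by
  have hz := genZ_ne_zero (K₀ := K₀) i
  have hz' := genZ_ne_zero (K₀ := K₀) (i + 1)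
  field_simp

/-- The two outer brackets through the ratio `x = z_i/z_{i+1}`. [folklore] -/
theorem exch_coeff₂ (q : K₀) (i : ℕ) :
    genC K₀ q * genZ K₀ i / genZ K₀ (i + 1) = genC K₀ q * (genZ K₀ i / genZ K₀ (i + 1)) := by ring

/-- `σ_i (z_i/z_{i+1}) = (z_i/z_{i+1})⁻¹`. [folklore] -/
theorem genSwap_ratio (i : ℕ) : genSwap K₀ i (genZ K₀ i / genZ K₀ (i + 1)) = (genZ K₀ i / genZ K₀ (i + 1))⁻¹ := by
  rw [map_div₀, genSwap_genZ, genSwap_genZ, zswap_self, zswap_succ, inv_div]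

/-- `[z_i/z_{i+1}] ≠ 0`. [folklore] -/
theorem qbr_ratio_ne_zero (i : ℕ) : qbr (genZ K₀ i / genZ K₀ (i + 1)) ≠ 0 :=
  qbr_ne_zero_of_sq_ne_one (div_ne_zero (genZ_ne_zero _) (genZ_ne_zero _)) (genRatio_sq_ne_one i)

/-- `[q z_i/z_{i+1}] ≠ 0` (`q ≠ 0`). [folklore] -/
theorem qbr_genC_mul_ratio_ne_zero {q : K₀} (hq : q ≠ 0) (i : ℕ) :
    qbr (genC K₀ q * (genZ K₀ i / genZ K₀ (i + 1))) ≠ 0 := by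
  have hc : genC K₀ q ≠ 0 := toRF_ne_zero_of_eval (fun _ => 1) (by simp [hq])
  refine qbr_ne_zero_of_sq_ne_one (mul_ne_zero hc (div_ne_zero (genZ_ne_zero _) (genZ_ne_zero _))) ?_
  rw [mul_pow, div_pow, mul_div_assoc', Ne, div_eq_one_iff_eq (pow_ne_zero _ (genZ_ne_zero _))]
  unfold genC genZ; rw [← map_pow (toRF K₀), ← map_pow (toRF K₀), ← map_pow (toRF K₀), ← map_mul (toRF K₀)]
  refine toRF_ne_of_eval (fun n => if n = i then (0 : K₀) else 1) ?_
  simp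

/-- `[q z_{i+1}/z_i] ≠ 0` (`q ≠ 0`). [folklore] -/
theorem qbr_genC_div_ratio_ne_zero {q : K₀} (hq : q ≠ 0) (i : ℕ) :
    qbr (genC K₀ q / (genZ K₀ i / genZ K₀ (i + 1))) ≠ 0 := by
  have hc : genC K₀ q ≠ 0 := toRF_ne_zero_of_eval (fun _ => 1) (by simp [hq])
  refine qbr_ne_zero_of_sq_ne_one (div_ne_zero hc (div_ne_zero (genZ_ne_zero _) (genZ_ne_zero _))) ?_
  rw [div_pow, div_pow, div_div_eq_mul_div, Ne, div_eq_one_iff_eq (pow_ne_zero _ (genZ_ne_zero _))]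
  unfold genC genZ; rw [← map_pow (toRF K₀), ← map_pow (toRF K₀), ← map_pow (toRF K₀), ← map_mul (toRF K₀)]
  refine toRF_ne_of_eval (fun n => if n = i + 1 then (0 : K₀) else 1) ?_
  simp

/-- `e` commutes with `σ_i` on the values. [folklore] -/
theorem genSwap_ipPush_apply (i : ℕ) (g : ColPattern m → ColPattern m) (ψ : ColPattern m → RapidityField K₀) (Q : ColPattern m) :
    genSwap K₀ i (ipPush g ψ Q) = ipPush g (fun Q => genSwap K₀ i (ψ Q)) Q := by
  unfold ipPush; rw [map_sum]

/-- **`σ_i(e ψ) = e ψ`** from an exact exchange relation. [folklore] -/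
theorem IsExactExchange.genSwap_ipPush (hq : q ^ 2 + q + 1 = 0) (hex : IsExactExchange q i g ψ) (Q : ColPattern m) :
    genSwap K₀ i (ipPush g ψ Q) = ipPush g ψ Q := by
  have hq0 : q ≠ 0 := by rintro rfl; norm_num at hq
  have hne := qbr_ratio_ne_zero (K₀ := K₀) i
  have hexQ := hex Q
  rw [exch_coeff₁, exch_coeff₂] at hexQ
  have hexσ := congrArg (genSwap K₀ i) hexQ
  rw [map_sub, map_mul, map_mul, map_mul, genSwap_qbr, genSwap_qbr, genSwap_qbr, map_div₀, map_mul, genSwap_ratio,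
    genSwap_genC, genSwap_genSwap, div_inv_eq_mul, qbr_inv', ← div_eq_mul_inv] at hexσ
  generalize genZ K₀ i / genZ K₀ (i + 1) = x at hexQ hexσ hne
  have key : qbr x * (genSwap K₀ i (ipPush g ψ Q) - ipPush g ψ Q) = 0 := by linear_combination hexQ + hexσ
  exact sub_eq_zero.1 ((mul_eq_zero.1 key).resolve_left hne)

/-- **`e(e ψ) = e ψ`** from an exact exchange relation (apply `e` to it). [folklore] -/
theorem IsExactExchange.ipPush_ipPush (hq : q ^ 2 + q + 1 = 0) (hex : IsExactExchange q i g ψ) :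
    ipPush g (ipPush g ψ) = ipPush g ψ := by
  have hne := qbr_ratio_ne_zero (K₀ := K₀) i
  have hquad := qbr_quad_identity (genC_quad (K₀ := K₀) hq) (genZ K₀ i / genZ K₀ (i + 1))
  funext Q
  have hfun : (fun Q => qbr (genC K₀ q / (genZ K₀ i / genZ K₀ (i + 1))) * ψ Q - qbr (genZ K₀ i / genZ K₀ (i + 1)) * ipPush g ψ Q) =
      fun Q => qbr (genC K₀ q * (genZ K₀ i / genZ K₀ (i + 1))) * genSwap K₀ i (ψ Q) := by
    funext Q; have := hex Q; rw [exch_coeff₁, exch_coeff₂] at this; exact this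
  have hE := congrFun (congrArg (ipPush g) hfun) Q
  rw [ipPush_sub_smul] at hE
  simp only at hE
  rw [show (ipPush g fun Q => qbr (genC K₀ q * (genZ K₀ i / genZ K₀ (i + 1))) * genSwap K₀ i (ψ Q)) Q =
      qbr (genC K₀ q * (genZ K₀ i / genZ K₀ (i + 1))) * ipPush g (fun Q => genSwap K₀ i (ψ Q)) Q by
    unfold ipPush; rw [Finset.mul_sum], ← genSwap_ipPush_apply, hex.genSwap_ipPush hq] at hE
  generalize genZ K₀ i / genZ K₀ (i + 1) = x at hE hne hquad
  -- hE : [c/x] E - [x] E(E) = [c x] E  ⇒  [x] (E(E) - E) = 0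
  have key : qbr x * (ipPush g (ipPush g ψ) Q - ipPush g ψ Q) = 0 := by linear_combination -hE - ipPush g ψ Q * hquad
  exact sub_eq_zero.1 ((mul_eq_zero.1 key).resolve_left hne)

/-- The support of `e ψ` is inside the support of `ψ` (exact exchange). [folklore] -/
theorem IsExactExchange.support_ipPush (hex : IsExactExchange q i g ψ) {Q : ColPattern m}
    (hQ : ipPush g ψ Q ≠ 0) : ψ Q ≠ 0 := by
  intro h0
  have := hex Q
  rw [h0, mul_zero, map_zero, mul_zero, zero_sub, neg_eq_zero, mul_eq_zero] at this
  exact hQ (this.resolve_left (qbr_ratio_ne_zero i))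

/-- Bilinear expansion of the junction form. [folklore] -/
theorem ipJform_lin (a b a' b' : RapidityField K₀) (u₁ u₂ v₁ v₂ : ColPattern m → RapidityField K₀) :
    ipJform (fun Q => a * u₁ Q + b * u₂ Q) (fun Q => a' * v₁ Q + b' * v₂ Q) =
      a * a' * ipJform u₁ v₁ + a * b' * ipJform u₁ v₂ + b * a' * ipJform u₂ v₁ + b * b' * ipJform u₂ v₂ := by
  unfold ipJform
  simp only [Finset.mul_sum, ← Finset.sum_add_distrib]
  refine Finset.sum_congr rfl fun Q _ => Finset.sum_congr rfl fun Q' _ => by ring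

/-- `σ_i` of the junction form. [folklore] -/
theorem genSwap_ipJform (i : ℕ) (u v : ColPattern m → RapidityField K₀) :
    genSwap K₀ i (ipJform u v) = ipJform (fun Q => genSwap K₀ i (u Q)) (fun Q => genSwap K₀ i (v Q)) := by
  unfold ipJform; rw [map_sum]
  refine Finset.sum_congr rfl fun Q _ => ?_
  rw [map_sum]
  refine Finset.sum_congr rfl fun Q' _ => ?_
  rw [map_mul, map_mul]; congr 1; split_ifs <;> simp

/-- **Symmetry of the transposition pairing in an unmarked rapidity pair.** If `ψ` satisfies an
exact exchange relation at level `i` (`1 ≤ i ≤ 2m`) whose move is self-adjoint for the junction on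
the support of `ψ`, then `σ_i N = N` and `σ_i Z = Z`. [cite: IkhlefPonsaing2012, Prop. 4.1] -/
theorem IsExactExchange.genSwap_ipNpair (hq : q ^ 2 + q + 1 = 0) (hex : IsExactExchange q i g ψ) (hi : 1 ≤ i)
    (hiL : i + 1 ≤ 2 * m + 1)
    (hadj : ∀ Q Q', ψ Q ≠ 0 → ψ Q' ≠ 0 →
      ipJunction m (Fin.last m) (lump (g Q)) Q' = ipJunction m (Fin.last m) Q (lump (g Q'))) :
    genSwap K₀ i (ipNpair ψ) = ipNpair ψ ∧ genSwap K₀ i (ipZsum ψ) = ipZsum ψ := by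
  have hq0 : q ≠ 0 := by rintro rfl; norm_num at hq
  set u : ColPattern m → RapidityField K₀ := fun Q => genInvAll K₀ (2 * m + 1) (ψ Q) with hu
  have hA := qbr_genC_mul_ratio_ne_zero (K₀ := K₀) hq0 i
  have hD := qbr_genC_div_ratio_ne_zero (K₀ := K₀) hq0 i
  have hB := qbr_ratio_ne_zero (K₀ := K₀) i
  have hquad := qbr_quad_identity (genC_quad (K₀ := K₀) hq) (genZ K₀ i / genZ K₀ (i + 1))
  -- σ on `ψ`
  have hσψ : ∀ Q, genSwap K₀ i (ψ Q) = (qbr (genC K₀ q / (genZ K₀ i / genZ K₀ (i + 1))) * ψ Q -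
      qbr (genZ K₀ i / genZ K₀ (i + 1)) * ipPush g ψ Q) / qbr (genC K₀ q * (genZ K₀ i / genZ K₀ (i + 1))) := by
    intro Q; rw [eq_div_iff hA]; have := hex Q; rw [exch_coeff₁, exch_coeff₂] at this; linear_combination -this
  -- σ on `u`
  have hιx : genInvAll K₀ (2 * m + 1) (genZ K₀ i / genZ K₀ (i + 1)) = (genZ K₀ i / genZ K₀ (i + 1))⁻¹ := by
    rw [map_div₀, genInvAll_genZ, genInvAll_genZ, if_pos ⟨hi, by omega⟩, if_pos ⟨by omega, hiL⟩, inv_div]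
    have := genZ_ne_zero (K₀ := K₀) i; have := genZ_ne_zero (K₀ := K₀) (i + 1); field_simp
  have hσu : ∀ Q, genSwap K₀ i (u Q) = (qbr (genC K₀ q * (genZ K₀ i / genZ K₀ (i + 1))) * u Q +
      qbr (genZ K₀ i / genZ K₀ (i + 1)) * ipPush g u Q) / qbr (genC K₀ q / (genZ K₀ i / genZ K₀ (i + 1))) := by
    intro Q
    rw [hu]; simp only
    rw [← genInvAll_genSwap hi hiL, hσψ, map_div₀, map_sub, map_mul, map_mul, genInvAll_qbr, genInvAll_qbr, genInvAll_qbr,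
      map_div₀, map_mul, hιx, genInvAll_genC, div_inv_eq_mul, qbr_inv', ← div_eq_mul_inv, map_ipPush]
    ring
  -- adjointness on the relevant vectors
  have hsuppE : ∀ Q, ipPush g ψ Q ≠ 0 → ψ Q ≠ 0 := fun Q => hex.support_ipPush
  have hsuppu : ∀ Q, u Q ≠ 0 → ψ Q ≠ 0 := fun Q h h0 => h (by rw [hu]; simp [h0])
  have hadj1 : ipJform (ipPush g u) ψ = ipJform u (ipPush g ψ) :=
    sum_pushforward_junction_comm _ g u ψ fun Q Q' hQ hQ' => hadj Q Q' (hsuppu Q hQ) hQ'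
  have hadj2 : ipJform (ipPush g u) (ipPush g ψ) = ipJform u (ipPush g (ipPush g ψ)) :=
    sum_pushforward_junction_comm _ g u (ipPush g ψ) fun Q Q' hQ hQ' => hadj Q Q' (hsuppu Q hQ) (hsuppE Q' hQ')
  rw [hex.ipPush_ipPush hq] at hadj2
  constructor
  · -- the numerator
    rw [ipNpair_eq, genSwap_ipJform]
    have hfu : (fun Q => genSwap K₀ i (u Q)) = fun Q =>
        (qbr (genC K₀ q * (genZ K₀ i / genZ K₀ (i + 1))) / qbr (genC K₀ q / (genZ K₀ i / genZ K₀ (i + 1)))) * u Q +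
        (qbr (genZ K₀ i / genZ K₀ (i + 1)) / qbr (genC K₀ q / (genZ K₀ i / genZ K₀ (i + 1)))) * ipPush g u Q := by
      funext Q; rw [hσu]; ring
    have hfψ : (fun Q => genSwap K₀ i (ψ Q)) = fun Q =>
        (qbr (genC K₀ q / (genZ K₀ i / genZ K₀ (i + 1))) / qbr (genC K₀ q * (genZ K₀ i / genZ K₀ (i + 1)))) * ψ Q +
        (-qbr (genZ K₀ i / genZ K₀ (i + 1)) / qbr (genC K₀ q * (genZ K₀ i / genZ K₀ (i + 1)))) * ipPush g ψ Q := by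
      funext Q; rw [hσψ]; ring
    rw [show (fun Q => genSwap K₀ i (genInvAll K₀ (2 * m + 1) (ψ Q))) = fun Q => genSwap K₀ i (u Q) from rfl, hfu, hfψ,
      ipJform_lin, hadj1, hadj2]
    generalize genZ K₀ i / genZ K₀ (i + 1) = x at hA hB hD hquad
    rw [← hquad] at hD ⊢
    field_simp
    ring
  · -- the partition sum
    unfold ipZsum
    rw [map_sum, Finset.sum_congr rfl fun Q _ => hσψ Q, ← Finset.sum_div, Finset.sum_sub_distrib, ← Finset.mul_sum,
      ← Finset.mul_sum, sum_ipPush, div_eq_iff hA]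
    generalize genZ K₀ i / genZ K₀ (i + 1) = x at hA hB hD hquad
    linear_combination (-(∑ Q, ψ Q)) * hquad

/-- **`σ_i N = N`, `σ_i Z = Z` at the odd levels `i = 2j'+1`** (exact exchange with the join
`e_i = join_{j', j'+1}`; ground-state support). [cite: IkhlefPonsaing2012, Prop. 4.1] -/
theorem genSwap_ipNpair_odd (hq : q ^ 2 + q + 1 = 0) {ψ : ColPattern m → RapidityField K₀}
    (hsupp : ∀ Q, ψ Q ≠ 0 → IsValid 0 Q ∧ IsPlanar Q ∧ lump Q = Q) (j' : Fin m)
    (hex : IsExactExchange q (2 * (j' : ℕ) + 1) (cpJoin (Fin.castSucc j') j'.succ) ψ) :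
    genSwap K₀ (2 * (j' : ℕ) + 1) (ipNpair ψ) = ipNpair ψ ∧ genSwap K₀ (2 * (j' : ℕ) + 1) (ipZsum ψ) = ipZsum ψ := by
  refine hex.genSwap_ipNpair hq (by omega) (by have := j'.2; omega) fun Q Q' hQ hQ' => ?_
  rw [ipJunction_lump_left, ipJunction_lump_right,
    ipJunction_cpJoin_left_eq_right _ _ _ (hsupp Q hQ).1 (hsupp Q' hQ').1]

/-- **`σ_i N = N`, `σ_i Z = Z` at the even levels `i = 2b` away from the marked top site**
(`b = b₀ + 1 < m`; exact exchange with `e_i = iso_b`). [cite: IkhlefPonsaing2012, Prop. 4.1] -/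
theorem genSwap_ipNpair_even (hq : q ^ 2 + q + 1 = 0) {ψ : ColPattern m → RapidityField K₀}
    (hsupp : ∀ Q, ψ Q ≠ 0 → IsValid 0 Q ∧ IsPlanar Q ∧ lump Q = Q) (b0 : Fin m) (hb : (b0 : ℕ) + 1 < m)
    (hex : IsExactExchange q (2 * (b0 : ℕ) + 2) (cpIsolate b0.succ) ψ) :
    genSwap K₀ (2 * (b0 : ℕ) + 2) (ipNpair ψ) = ipNpair ψ ∧ genSwap K₀ (2 * (b0 : ℕ) + 2) (ipZsum ψ) = ipZsum ψ := by
  have hbl : b0.succ ≠ Fin.last m := by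
    intro h; have := congrArg Fin.val h; simp at this; omega
  refine hex.genSwap_ipNpair hq (by omega) (by omega) fun Q Q' hQ hQ' => ?_
  rw [ipJunction_lump_left, ipJunction_lump_right,
    ipJunction_cpIsolate_left_eq_right hbl (hsupp Q hQ).1 (hsupp Q' hQ').1]

/-! ### Inversion invariance -/

/-- `genInv k` commutes with `ι_L`. [folklore] -/
theorem genInv_genInvAll (k L : ℕ) (x : RapidityField K₀) :
    genInv K₀ k (genInvAll K₀ L x) = genInvAll K₀ L (genInv K₀ k x) := by
  have : (genInv K₀ k).comp (genInvAll K₀ L) = (genInvAll K₀ L).comp (genInv K₀ k) := by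
    refine rapidityField_ringHom_ext (fun a => ?_) (fun n => ?_)
    · simp [genInvAll_genC, genInv_genC]
    · simp only [RingHom.comp_apply, genInvAll_genZ, genInv_genZ, Function.update_apply]
      by_cases hn : n = k
      · subst hn
        simp only [if_true]
        split_ifs with h
        · rw [map_inv₀, map_inv₀, genInv_genZ, Function.update_self, genInvAll_genZ, if_pos h]
        · rw [map_inv₀, genInv_genZ, Function.update_self, genInvAll_genZ, if_neg h]
      · rw [if_neg hn]
        split_ifs with h
        · rw [map_inv₀, genInv_genZ, Function.update_of_ne hn, genInvAll_genZ, if_pos h]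
        · rw [genInv_genZ, Function.update_of_ne hn, genInvAll_genZ, if_neg h]
  exact RingHom.congr_fun this x

/-- **Inversion invariance of the pairing**: if `genInv k ψ = z_k^{2a} ψ` (`1 ≤ k ≤ L`) then
`genInv k N = N` and `genInv k (Z · ι Z) = Z · ι Z`. [cite: IkhlefPonsaing2012, Prop. 4.1] -/
theorem genInv_ipNpair_of_zpow {k : ℕ} (hk : 1 ≤ k) (hkL : k ≤ 2 * m + 1) {ψ : ColPattern m → RapidityField K₀}
    {a : ℤ} (hrefl : ∀ Q, genInv K₀ k (ψ Q) = genZ K₀ k ^ (2 * a) * ψ Q) :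
    genInv K₀ k (ipNpair ψ) = ipNpair ψ ∧
      genInv K₀ k (ipZsum ψ * genInvAll K₀ (2 * m + 1) (ipZsum ψ)) = ipZsum ψ * genInvAll K₀ (2 * m + 1) (ipZsum ψ) := by
  have hz : genZ K₀ k ≠ 0 := genZ_ne_zero k
  have hιz : genInvAll K₀ (2 * m + 1) (genZ K₀ k) = (genZ K₀ k)⁻¹ := by rw [genInvAll_genZ, if_pos ⟨hk, hkL⟩]
  have hu : ∀ Q, genInv K₀ k (genInvAll K₀ (2 * m + 1) (ψ Q)) = (genZ K₀ k ^ (2 * a))⁻¹ * genInvAll K₀ (2 * m + 1) (ψ Q) := by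
    intro Q; rw [genInv_genInvAll, hrefl, map_mul, map_zpow₀, hιz, inv_zpow]
  constructor
  · unfold ipNpair
    rw [map_sum]
    refine Finset.sum_congr rfl fun Q _ => ?_
    rw [map_sum]
    refine Finset.sum_congr rfl fun Q' _ => ?_
    rw [map_mul, map_mul, hu, hrefl, show genInv K₀ k (if ipJunction m (Fin.last m) Q Q' = true then 1 else 0) =
      (if ipJunction m (Fin.last m) Q Q' = true then 1 else 0) by split_ifs <;> simp]
    have : genZ K₀ k ^ (2 * a) ≠ 0 := zpow_ne_zero _ hz
    field_simp
  · have hZ : genInv K₀ k (ipZsum ψ) = genZ K₀ k ^ (2 * a) * ipZsum ψ := by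
      unfold ipZsum; rw [map_sum, Finset.mul_sum]; exact Finset.sum_congr rfl fun Q _ => hrefl Q
    rw [map_mul, genInv_genInvAll, hZ, map_mul, map_zpow₀, hιz, inv_zpow]
    have : genZ K₀ k ^ (2 * a) ≠ 0 := zpow_ne_zero _ hz
    field_simp

/-- `σ_i ∘ genInv i ∘ σ_i = genInv (i+1)`. [folklore] -/
theorem genSwap_genInv_genSwap (i : ℕ) (x : RapidityField K₀) :
    genSwap K₀ i (genInv K₀ i (genSwap K₀ i x)) = genInv K₀ (i + 1) x := by
  have : (genSwap K₀ i).toRingHom.comp ((genInv K₀ i).comp (genSwap K₀ i).toRingHom) = genInv K₀ (i + 1) := by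
    refine rapidityField_ringHom_ext (fun a => ?_) (fun n => ?_)
    · simp [genSwap_genC, genInv_genC]
    · simp only [RingHom.comp_apply, RingEquiv.toRingHom_eq_coe, RingHom.coe_coe, genSwap_genZ, genInv_genZ,
        Function.update_apply]
      rw [zswap]
      by_cases h1 : n = i
      · subst h1
        rw [if_pos rfl, genInv_genZ, Function.update_of_ne (by omega), genSwap_genZ, zswap_succ, if_neg (by omega)]
      · by_cases h2 : n = i + 1
        · subst h2
          rw [if_neg h1, if_pos rfl, genInv_genZ, Function.update_self, map_inv₀, genSwap_genZ, zswap_self, if_pos rfl]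
        · rw [if_neg h1, if_neg h2, genInv_genZ, Function.update_of_ne h1, genSwap_genZ, zswap_of_ne _ h1 h2, if_neg h2]
  exact RingHom.congr_fun this x

/-- Invariance propagates one level up through a swap symmetry. [folklore] -/
theorem genInv_succ_of_invariant {i : ℕ} {x : RapidityField K₀} (hσ : genSwap K₀ i x = x) (hι : genInv K₀ i x = x) :
    genInv K₀ (i + 1) x = x := by
  rw [← genSwap_genInv_genSwap, hσ, hι, hσ]

end Pairing

end Literature.Probability.Percolation
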